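import Mathlib
import HarnessLib

/-!
# `TypeIQuarterGate`: the BOOKKEEPING CEILING for the crux `QuarterLawTypeI`
# (stmt-NavierStokesRegularity-23726) — every a-priori enstrophy fact landed so far is satisfied by a
# profile that violates the quarter law

`--supports stmt-NavierStokesRegularity-23726` (helper; a CEILING theorem in the genre of the tree's
`StrainCube.constantForm_rung_ceiling`: it certifies what a class of arguments CANNOT reach).

Along a (hypothetical) sup-norm Type-I blow-up of K1's class, write `Z(t) = ∫‖curl u(t)‖²`.  The tree
holds exactly the following a-priori information about the scalar function `Z` on `[0,T)`:

* (A) **depleted Grönwall, exponent `a = κ²C²/2 > 1/2`**: `t ↦ Z(t)(T−t)^a` is non-increasing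
  (`QuarterLawExponent.lintegral_curl_sq_le_rpow_sharp_of_rate`, p820231; K1 is open exactly for
  `C > 18 − 9√3`, i.e. `a > 1/2`);
* (S) **two-time Serrin transfer under the rate**: `Z(t) ≤ exp(γ(t−s)/(T−t))·Z(s)` for `s ≤ t < T`,
  `γ = C'²/2` (`QuarterLawWindow.lintegral_frobeniusNormSq_le_exp_mul_of_bound`, p820364; the engine
  of the backward-window transfer p823532 and of the octave sampling p824687);
* (D) **finite total dissipation**: `∫₀ᵀ Z ≤ E₀/(2ν)` (`QuarterLawBackwardWindow.lintegral_Ioo_lintegral_curl_sq_lt_top`);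
* consequences: the exponent-`1` cap and `Z(t) = o((T−t)⁻¹)` (p820231, p823532), and Leray's floor
  `Z(t) ≥ cν^{3/2}/√(T−t)` (tree `leray_blowup_rate_top_holds`).

`bookkeeping_ceiling` — for EVERY `T > 0`, EVERY exponent `a > 1/2`, EVERY Serrin constant
`γ > 1/2` and EVERY budget `D > 0` there is a positive continuous profile `Z` on `[0,T)` satisfying
(A), (S), (D) (with budget `D`), the little-`o` cap `(T−t)Z(t) → 0`, Leray's floor for every
constant `c` near `T` — and nevertheless `Z(t)√(T−t) → ∞`: for every `K` the quarter-law bound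
`Z(t) ≤ K/√(T−t)` FAILS on a whole terminal window.  Witness: `Z(t) = ε(T−t)^{−b}` with
`b = min(3/4, a, γ) ∈ (1/2, 1)` and `ε = D(1−b)/T^{1−b}`.

READING (repair census for 23726, numbers not adjectives): no argument whose only inputs are the scalar
facts (A) with some `a > 1/2`, (S) with some `γ > 1/2`, (D), the little-`o` cap and Leray's floor can
prove `QuarterLawTypeI`; the missing input must see the SPATIAL structure of the slices (the weak-`L³`
bound 24108 ⟺ the scale-uniform ε-concentration count 23970 ⟺ K1, p818591/p816056), or lower the
depleted exponent to `a ≤ 1/2` along the flow (which for maximal solutions is the empty stratum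
`κC ≤ 1`, p820231).  The profiles here are scalar functions, not Navier–Stokes solutions: this is a
statement about the METHOD, and nothing about Navier–Stokes regularity or blow-up is claimed.
[folklore]
-/

-- the problem directory repeats the summit name (`NavierStokesRegularity/NavierStokesRegularity`)
set_option linter.dupNamespace false

noncomputable section

open Set Filter Topology MeasureTheory

namespace Summit.NavierStokesRegularity.NavierStokesRegularity.Theorems

namespace QuarterLawCeiling

/-! ### The power profiles `ε (T−t)^{−b}` -/

/-- `ε(T−t)^{−b}·(T−t)^a = ε(T−t)^{a−b}` for `t < T`. [folklore] -/
theorem power_mul_rpow_eq {T a b t : ℝ} (ht : t < T) (ε : ℝ) :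
    ε * (T - t) ^ (-b) * (T - t) ^ a = ε * (T - t) ^ (a - b) := by
  have hx : 0 < T - t := sub_pos.2 ht
  rw [mul_assoc, ← Real.rpow_add hx, show -b + a = a - b by ring]

/-- (A) for the power profile: `t ↦ ε(T−t)^{−b}(T−t)^a` is non-increasing on `(−∞,T)` when `b ≤ a`,
`ε ≥ 0`. [folklore] -/
theorem antitoneOn_power {T a b ε : ℝ} (hε : 0 ≤ ε) (hba : b ≤ a) :
    AntitoneOn (fun t => ε * (T - t) ^ (-b) * (T - t) ^ a) (Iio T) := by
  intro s hs t ht hst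
  simp only [mem_Iio] at hs ht
  show ε * (T - t) ^ (-b) * (T - t) ^ a ≤ ε * (T - s) ^ (-b) * (T - s) ^ a
  rw [power_mul_rpow_eq ht, power_mul_rpow_eq hs]
  have h1 : (T - t) ^ (a - b) ≤ (T - s) ^ (a - b) :=
    Real.rpow_le_rpow (sub_pos.2 ht).le (by linarith) (sub_nonneg.2 hba)
  exact mul_le_mul_of_nonneg_left h1 hε

/-- (S) for the power profile: `ε(T−t)^{−b} ≤ exp(γ(t−s)/(T−t))·ε(T−s)^{−b}` for `s ≤ t < T` when
`0 ≤ b ≤ γ`, `ε ≥ 0` (ratio `((T−s)/(T−t))^b = (1+y)^b ≤ (1+y)^γ ≤ e^{γy}`, `y = (t−s)/(T−t)`).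
[folklore] -/
theorem power_le_exp_mul_power {T b γ ε s t : ℝ} (hε : 0 ≤ ε) (hb : 0 ≤ b) (hbγ : b ≤ γ)
    (hst : s ≤ t) (ht : t < T) :
    ε * (T - t) ^ (-b) ≤ Real.exp (γ * (t - s) / (T - t)) * (ε * (T - s) ^ (-b)) := by
  have hxt : 0 < T - t := sub_pos.2 ht
  have hxs : 0 < T - s := by linarith
  have hpt : (T - t) ^ b ≠ 0 := (Real.rpow_pos_of_pos hxt b).ne'
  have hps : (T - s) ^ b ≠ 0 := (Real.rpow_pos_of_pos hxs b).ne'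
  -- `(T−t)^{−b} = (T−s)^{−b} · ((T−s)/(T−t))^b`
  have hkey : (T - t) ^ (-b) = (T - s) ^ (-b) * ((T - s) / (T - t)) ^ b := by
    rw [Real.div_rpow hxs.le hxt.le, Real.rpow_neg hxs.le, Real.rpow_neg hxt.le]
    field_simp
  -- the ratio bound
  set y : ℝ := (t - s) / (T - t) with hy
  have hy0 : 0 ≤ y := div_nonneg (sub_nonneg.2 hst) hxt.le
  have hratio : (T - s) / (T - t) = 1 + y := by
    rw [hy]; field_simp; ring
  have hb1 : ((T - s) / (T - t)) ^ b ≤ Real.exp (γ * (t - s) / (T - t)) := by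
    rw [hratio]
    calc (1 + y) ^ b ≤ (1 + y) ^ γ := Real.rpow_le_rpow_of_exponent_le (by linarith) hbγ
      _ ≤ (Real.exp y) ^ γ :=
          Real.rpow_le_rpow (by linarith) (by linarith [Real.add_one_le_exp y]) (hb.trans hbγ)
      _ = Real.exp (y * γ) := (Real.exp_mul y γ).symm
      _ = Real.exp (γ * (t - s) / (T - t)) := by rw [hy]; congr 1; ring
  calc ε * (T - t) ^ (-b) = ε * (T - s) ^ (-b) * ((T - s) / (T - t)) ^ b := by
        rw [hkey, mul_assoc]
    _ ≤ ε * (T - s) ^ (-b) * Real.exp (γ * (t - s) / (T - t)) :=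
        mul_le_mul_of_nonneg_left hb1 (mul_nonneg hε (Real.rpow_nonneg hxs.le _))
    _ = Real.exp (γ * (t - s) / (T - t)) * (ε * (T - s) ^ (-b)) := by ring

/-- (D) for the power profile: `∫₀ᵀ (T−t)^{−b} dt = T^{1−b}/(1−b)` for `b < 1` (for `T < 0` both
sides are the junk values of `rpow`/the oriented integral, and the identity still holds). [folklore] -/
theorem integral_power {T b : ℝ} (hb : b < 1) :
    ∫ t in (0:ℝ)..T, (T - t) ^ (-b) = T ^ (1 - b) / (1 - b) := by
  have h := intervalIntegral.integral_comp_sub_left (fun x : ℝ => x ^ (-b)) T (a := 0) (b := T)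
  simp only [sub_self, sub_zero] at h
  rw [h, integral_rpow (Or.inl (by linarith)), Real.zero_rpow (by linarith), sub_zero,
    show -b + 1 = 1 - b by ring]

/-- The power profile is interval-integrable on `[0,T]` for `b < 1`. [folklore] -/
theorem intervalIntegrable_power {T b : ℝ} (hb : b < 1) :
    IntervalIntegrable (fun t => (T - t) ^ (-b)) volume 0 T := by
  have h := (intervalIntegral.intervalIntegrable_rpow' (a := T) (b := 0) (r := -b)
    (by linarith)).comp_sub_left T
  simpa only [sub_self, sub_zero] using h

/-- The little-`o` cap for the power profile: `(T−t)·ε(T−t)^{−b} = ε(T−t)^{1−b} → 0` (`b < 1`); for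
every `η > 0` it is `≤ η` on a terminal window. [folklore] -/
theorem power_littleO {T b ε : ℝ} (hb : b < 1) (hε : 0 < ε) :
    ∀ η : ℝ, 0 < η → ∃ t₀ < T, ∀ t ∈ Ico t₀ T, (T - t) * (ε * (T - t) ^ (-b)) ≤ η := by
  intro η hη
  set x₀ : ℝ := (η / ε) ^ (1 - b)⁻¹ with hx₀
  have hx₀pos : 0 < x₀ := Real.rpow_pos_of_pos (div_pos hη hε) _
  refine ⟨T - x₀, by linarith, fun t ht => ?_⟩
  have hxt : 0 < T - t := sub_pos.2 ht.2
  have hle : T - t ≤ x₀ := by linarith [ht.1]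
  have h1 : (T - t) * (ε * (T - t) ^ (-b)) = ε * (T - t) ^ (1 - b) := by
    rw [sub_eq_add_neg (1 : ℝ) b, Real.rpow_add hxt, Real.rpow_one]; ring
  rw [h1]
  have h2 : (T - t) ^ (1 - b) ≤ x₀ ^ (1 - b) := Real.rpow_le_rpow hxt.le hle (by linarith)
  have h3 : x₀ ^ (1 - b) = η / ε := by
    rw [hx₀, Real.rpow_inv_rpow (div_pos hη hε).le (by linarith : (1 - b) ≠ 0)]
  calc ε * (T - t) ^ (1 - b) ≤ ε * (η / ε) := by
        rw [← h3]; exact mul_le_mul_of_nonneg_left h2 hε.le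
    _ = η := by field_simp

/-- The power profile beats every `c/√(T−t)` on a terminal window when `b > 1/2`, `ε > 0`, `T > 0`
(Leray's floor shape holds near `T` for every `c`; the quarter-law bound fails for every `K`).
[folklore] -/
theorem sqrt_lt_power {T b ε : ℝ} (hT : 0 < T) (hb : 1 / 2 < b) (hε : 0 < ε) (c : ℝ) :
    ∃ t₀ < T, ∀ t ∈ Ico t₀ T, c / Real.sqrt (T - t) < ε * (T - t) ^ (-b) := by
  rcases le_or_gt c 0 with hc | hc
  · refine ⟨0, hT, fun t ht => ?_⟩
    have hxt : 0 < T - t := sub_pos.2 ht.2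
    exact lt_of_le_of_lt (div_nonpos_of_nonpos_of_nonneg hc (Real.sqrt_nonneg _))
      (mul_pos hε (Real.rpow_pos_of_pos hxt _))
  · set e : ℝ := b - 1 / 2 with he
    have he0 : 0 < e := by rw [he]; linarith
    set x₀ : ℝ := (ε / c) ^ e⁻¹ with hx₀
    have hx₀pos : 0 < x₀ := Real.rpow_pos_of_pos (div_pos hε hc) _
    refine ⟨max 0 (T - x₀ / 2), max_lt hT (by linarith), fun t ht => ?_⟩
    have hxt : 0 < T - t := sub_pos.2 ht.2
    have hlt : T - t < x₀ := by
      have := (le_max_right 0 (T - x₀ / 2)).trans ht.1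
      linarith
    -- `(T−t)^e < ε/c`
    have h1 : (T - t) ^ e < ε / c := by
      calc (T - t) ^ e < x₀ ^ e := Real.rpow_lt_rpow hxt.le hlt he0
        _ = ε / c := by rw [hx₀, Real.rpow_inv_rpow (div_pos hε hc).le he0.ne']
    -- hence `c < ε (T−t)^{−e}`
    have h2 : c < ε * (T - t) ^ (-e) := by
      rw [Real.rpow_neg hxt.le, ← div_eq_mul_inv, lt_div_iff₀ (Real.rpow_pos_of_pos hxt e)]
      calc c * (T - t) ^ e < c * (ε / c) := mul_lt_mul_of_pos_left h1 hc
        _ = ε := by field_simp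
    -- assemble: `c/√(T−t) = c (T−t)^{−1/2}`, `ε(T−t)^{−b} = ε(T−t)^{−e}(T−t)^{−1/2}`
    have hsqrt : c / Real.sqrt (T - t) = c * (T - t) ^ (-(1 / 2 : ℝ)) := by
      rw [Real.sqrt_eq_rpow, Real.rpow_neg hxt.le, div_eq_mul_inv]
    have hsplit : ε * (T - t) ^ (-b) = ε * (T - t) ^ (-e) * (T - t) ^ (-(1 / 2 : ℝ)) := by
      rw [mul_assoc, ← Real.rpow_add hxt, he]
      congr 1; congr 1; ring
    rw [hsqrt, hsplit]
    exact mul_lt_mul_of_pos_right h2 (Real.rpow_pos_of_pos hxt _)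

/-! ### The ceiling -/

/-- **THE BOOKKEEPING CEILING FOR `QuarterLawTypeI` (23726).** For every `T > 0`, every depleted
exponent `a > 1/2`, every Serrin constant `γ > 1/2` and every dissipation budget `D > 0` there is a
profile `Z : ℝ → ℝ`, positive and continuous on `[0,T)`, with
(A) `t ↦ Z(t)(T−t)^a` non-increasing on `[0,T)`;
(S) `Z(t) ≤ exp(γ(t−s)/(T−t))·Z(s)` for all `0 ≤ s ≤ t < T`;
(D) `Z` integrable on `[0,T]` with `∫₀ᵀ Z ≤ D`;
(o) for every `η > 0`, `(T−t)Z(t) ≤ η` on a terminal window (the exponent-`1` cap is never attained);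
(L) for every `c`, `c/√(T−t) < Z(t)` on a terminal window (Leray's floor shape; and, reading `c` as a
quarter-law constant `K`, the bound `Z(t) ≤ K/√(T−t)` FAILS near `T` for every `K`).
So the scalar a-priori facts landed on the crux (p820231, p820364, p823532, p824687 and the dissipation
budget) do not imply the quarter law: the missing input is spatial (24108 ⟺ 23970 ⟺ K1).  Witness
`Z(t) = ε(T−t)^{−b}`, `b = min(3/4, min(a, γ))`, `ε = D(1−b)/T^{1−b}`. [folklore] -/
theorem bookkeeping_ceiling {T a γ D : ℝ} (hT : 0 < T) (ha : 1 / 2 < a) (hγ : 1 / 2 < γ)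
    (hD : 0 < D) :
    ∃ Z : ℝ → ℝ,
      (∀ t ∈ Ico 0 T, 0 < Z t) ∧ ContinuousOn Z (Ico 0 T) ∧
      AntitoneOn (fun t => Z t * (T - t) ^ a) (Ico 0 T) ∧
      (∀ s t : ℝ, 0 ≤ s → s ≤ t → t < T → Z t ≤ Real.exp (γ * (t - s) / (T - t)) * Z s) ∧
      IntervalIntegrable Z volume 0 T ∧ (∫ t in (0:ℝ)..T, Z t) ≤ D ∧
      (∀ η : ℝ, 0 < η → ∃ t₀ < T, ∀ t ∈ Ico t₀ T, (T - t) * Z t ≤ η) ∧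
      (∀ c : ℝ, ∃ t₀ < T, ∀ t ∈ Ico t₀ T, c / Real.sqrt (T - t) < Z t) := by
  set b : ℝ := min (3 / 4) (min a γ) with hb
  have hb34 : b ≤ 3 / 4 := min_le_left _ _
  have hba : b ≤ a := (min_le_right _ _).trans (min_le_left _ _)
  have hbγ : b ≤ γ := (min_le_right _ _).trans (min_le_right _ _)
  have hb12 : 1 / 2 < b := lt_min (by norm_num) (lt_min ha hγ)
  have hb1 : b < 1 := by linarith
  have hb0 : 0 ≤ b := by linarith
  have h1b : (1 - b) ≠ 0 := by linarith
  have hTb : 0 < T ^ (1 - b) := Real.rpow_pos_of_pos hT _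
  have hTbne : T ^ (1 - b) ≠ 0 := hTb.ne'
  set ε : ℝ := D * (1 - b) / T ^ (1 - b) with hε
  have hε0 : 0 < ε := by rw [hε]; exact div_pos (mul_pos hD (by linarith)) hTb
  refine ⟨fun t => ε * (T - t) ^ (-b), ?_, ?_, ?_, ?_, ?_, ?_, power_littleO hb1 hε0,
    sqrt_lt_power hT hb12 hε0⟩
  · intro t ht
    exact mul_pos hε0 (Real.rpow_pos_of_pos (sub_pos.2 ht.2) _)
  · refine continuousOn_const.mul ?_
    exact (continuousOn_const.sub continuousOn_id).rpow_const fun t ht =>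
      Or.inl (sub_pos.2 ht.2).ne'
  · exact (antitoneOn_power hε0.le hba).mono fun t ht => ht.2
  · intro s t _ hst ht
    exact power_le_exp_mul_power hε0.le hb0 hbγ hst ht
  · exact (intervalIntegrable_power hb1).const_mul ε
  · have h1 : ∫ t in (0:ℝ)..T, ε * (T - t) ^ (-b) = ε * (T ^ (1 - b) / (1 - b)) := by
      rw [intervalIntegral.integral_const_mul, integral_power hb1]
    have h2 : ε * (T ^ (1 - b) / (1 - b)) = D := by
      rw [hε]; field_simp
    rw [h1, h2]

/-- **THE CEILING WITH A PRESCRIBED EXPONENT: no power law below the cap is reachable.** For every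
`T > 0`, every `b` with `1/2 < b < 1`, every depleted exponent `a ≥ b`, every Serrin constant `γ ≥ b`
and every budget `D > 0`, the profile `Z(t) = ε(T−t)^{−b}` (`ε = D(1−b)/T^{1−b}`) satisfies (A), (S),
(D), (o), (L) of `bookkeeping_ceiling` and has EXACTLY the power `b`:
`Z(t)·(T−t)^b = ε > 0` on `[0,T)`.  Reading: for a Type-I constant with `min(a, γ) ≥ 1` (all large
`C`) the scalar facts cannot prove `Z(t) = O((T−t)^{−b})` for ANY `b < 1` — the tree's cap
`Z = o((T−t)^{−1})` (p823532) is the end of scalar bookkeeping, and every power gain towards K1's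
`b = 1/2` needs spatial input. [folklore] -/
theorem bookkeeping_ceiling_exponent {T a γ D b : ℝ} (hT : 0 < T) (hb : 1 / 2 < b) (hb1 : b < 1)
    (hba : b ≤ a) (hbγ : b ≤ γ) (hD : 0 < D) :
    ∃ Z : ℝ → ℝ, ∃ ε : ℝ, 0 < ε ∧ (∀ t ∈ Ico 0 T, Z t * (T - t) ^ b = ε) ∧
      (∀ t ∈ Ico 0 T, 0 < Z t) ∧ ContinuousOn Z (Ico 0 T) ∧
      AntitoneOn (fun t => Z t * (T - t) ^ a) (Ico 0 T) ∧
      (∀ s t : ℝ, 0 ≤ s → s ≤ t → t < T → Z t ≤ Real.exp (γ * (t - s) / (T - t)) * Z s) ∧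
      IntervalIntegrable Z volume 0 T ∧ (∫ t in (0:ℝ)..T, Z t) ≤ D ∧
      (∀ η : ℝ, 0 < η → ∃ t₀ < T, ∀ t ∈ Ico t₀ T, (T - t) * Z t ≤ η) ∧
      (∀ c : ℝ, ∃ t₀ < T, ∀ t ∈ Ico t₀ T, c / Real.sqrt (T - t) < Z t) := by
  have hb0 : 0 ≤ b := by linarith
  have h1b : (1 - b) ≠ 0 := by linarith
  have hTb : 0 < T ^ (1 - b) := Real.rpow_pos_of_pos hT _
  have hTbne : T ^ (1 - b) ≠ 0 := hTb.ne'
  set ε : ℝ := D * (1 - b) / T ^ (1 - b) with hε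
  have hε0 : 0 < ε := by rw [hε]; exact div_pos (mul_pos hD (by linarith)) hTb
  refine ⟨fun t => ε * (T - t) ^ (-b), ε, hε0, ?_, ?_, ?_, ?_, ?_, ?_, ?_, power_littleO hb1 hε0,
    sqrt_lt_power hT hb hε0⟩
  · intro t ht
    rw [power_mul_rpow_eq ht.2, sub_self, Real.rpow_zero, mul_one]
  · intro t ht
    exact mul_pos hε0 (Real.rpow_pos_of_pos (sub_pos.2 ht.2) _)
  · refine continuousOn_const.mul ?_
    exact (continuousOn_const.sub continuousOn_id).rpow_const fun t ht =>
      Or.inl (sub_pos.2 ht.2).ne'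
  · exact (antitoneOn_power hε0.le hba).mono fun t ht => ht.2
  · intro s t _ hst ht
    exact power_le_exp_mul_power hε0.le hb0 hbγ hst ht
  · exact (intervalIntegrable_power hb1).const_mul ε
  · have h1 : ∫ t in (0:ℝ)..T, ε * (T - t) ^ (-b) = ε * (T ^ (1 - b) / (1 - b)) := by
      rw [intervalIntegral.integral_const_mul, integral_power hb1]
    have h2 : ε * (T ^ (1 - b) / (1 - b)) = D := by
      rw [hε]; field_simp
    rw [h1, h2]

end QuarterLawCeiling

end Summit.NavierStokesRegularity.NavierStokesRegularity.Theorems
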